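import Literature.MathematicalPhysics.QuantumFieldTheory.Balaban1983to89.B12Membership313II
import Literature.MathematicalPhysics.QuantumFieldTheory.Balaban1983to89.BlockAveragingEMLAnalyticMean
import HarnessLib

/-!
# Route `UnitScaleTilt`, crux K1 child «MinimiserStabilityRegPr» (stmt-QuantumFields-19200), stub V2′ `stub_halvingStep` — pillar P1♭, brick **J4a (generic half)**
# of the LEAD plan `T2FLAT-PLAN-v1.1-addendum-w5g4.md` (19200 evidence #46): **THE THREE-LEVEL BCH MAP OF A BLOCK FRAME IS THE ARITHMETIC MEAN UP TO AN
# `O(ζ + ℓ)`-LIPSCHITZ REMAINDER** ([Balaban1985RegularSpaces] Sect. E p.95 «the function Q′(u₁,λ) is almost equal to Q′λ … the error is of second order»,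
# here for the cell's double-bar frames; [Balaban1987RG1] (0.6)–(0.8) p.253)

Cell `ym3-torus` (HUMAN RULING D-0037: YM₃ on T³ is ladder rung R3, not the Clay problem), LEAD seat `ym-ust-19200-w5` gen 4.
`--supports stmt-QuantumFields-19200 --as helper`; def-free, 0 sorry, standard axioms.  Nothing here claims the stub, the crux or the gap.

WHY.  The top normalisation (o) of the P1♭ `core` reads, for a gauge copy `W^{g}`, `g = exp ∘ l`, through the block frame
`v(W^{g})(y) = eml_i[ g(emb y)·W(Γ_{y,x_i})·g(x_i)⁻¹ ]` (✓`Prop8ChartDoubleBar.vframeU`, ✓`Prop8Chart.holT_gaugeActT`): with `a := l(emb y)`, `b_i := l(x_i)`, `Z_i := log W(Γ_{y,x_i})`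
its logarithm is `mean_i bchLog a (bchLog Z_i (−b_i))` (`eml = exp ∘ mean ∘ log`), and the (o)-quantity `log(v(W^{g})(y)⁻¹·g(emb y))` is the THREE-LEVEL BCH expression
`F(a,b) := bchLog (−mean_i bchLog a (bchLog Z_i (−b_i))) a`.  THIS FILE proves, in a generic complete normed `ℂ`-algebra and for an arbitrary finite family, that
`F(a,b) − (−mean Z + mean b)` is `100(ζ + 2ℓ)`-Lipschitz in `(a, b)` (sup norms; `‖Z_i‖ ≤ ζ`, `‖a‖, ‖b_i‖ ≤ ℓ`, `ζ + 2ℓ ≤ 1/100`) and vanishes at `(a,b) = 0`: the base-point value `a` drops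
out of the linear part EXACTLY (plan v1.1 F-d), the linear part is the plain mean of `b`, and the nonlinearity is `O(ζ + ℓ)`-small — the input letter of the top-level
Prop. 5 step with (o) (plan J4b∕J4c).  Pure algebra + the BCH remainder letters ✓`B12Membership313II.norm_bchRem_le`∕`norm_bchRem_sub_bchRem_le`; the lattice
instantiation (`vframeU`, `dbarIterU`, stairs) is the sibling file `…CoreFrameLin`.

WHAT IS PROVED (§1 helpers on `meanCLM`; §2 the estimate):
* `meanCLM_const` (`mean (fun _ => a) = a`, nonempty index), `norm_meanCLM_le_of_forall_le`.
* ★ `threeLevelBCH_sub_mean_lipschitz` — `‖[F(a,b) − (−mean Z + mean b)] − [F(a′,b′) − (−mean Z + mean b′)]‖ ≤ 100(ζ + 2ℓ)·D` whenever `‖a − a′‖ ≤ D`, `‖b_i − b′_i‖ ≤ D`.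
* ★ `threeLevelBCH_sub_mean_le` — at `(a′, b′) = 0`: `‖F(a,b) − (−mean Z + mean b)‖ ≤ 100(ζ + 2ℓ)·ℓ`.
* `exp_threeLevelBCH` — the exact identity `exp (F(a,b)) = exp(−mean_i bchLog a (bchLog Z_i (−b_i)))·exp a` in the smallness regime (so `F` IS the logarithm of the (o)-quantity).
HONEST SCOPE: generic Banach-algebra bookkeeping; no lattice object appears.  Constants are not optimised (`100`).

References: T. Bałaban, CMP **99** (1985) 75–102 [Balaban1985RegularSpaces] (Sect. E pp.95–99); CMP **109** (1987) 249–301 [Balaban1987RG1] ((0.6)–(0.8) p.253).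
-/

set_option autoImplicit false

noncomputable section

namespace Summit.QuantumFields.YangMills.Theorems.P1FlatCoreFrameLinBCH

open NormedSpace
open Literature.MathematicalPhysics.QuantumFieldTheory.Balaban1983to89
open Literature.MathematicalPhysics.QuantumFieldTheory.Balaban1983to89.B7TransferAnalyticMean (meanCLM meanCLM_apply norm_meanCLM_apply_le)
open Literature.MathematicalPhysics.QuantumFieldTheory.Balaban1983to89.B12Membership313II (bchLog exp_bchLog norm_bchRem_le norm_bchRem_sub_bchRem_le
  norm_expMul_sub_one_lt_one)

variable {ι : Type*} [Fintype ι] {𝔸 : Type*} [NormedRing 𝔸] [NormedAlgebra ℂ 𝔸]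

/-! ## §1 Two helpers on the arithmetic mean -/

/-- The mean of a constant family is the constant (nonempty index). [folklore] -/
theorem meanCLM_const [Nonempty ι] (a : 𝔸) : meanCLM ι 𝔸 (fun _ : ι => a) = a := by
  rw [meanCLM_apply, Finset.sum_const, Finset.card_univ, ← Nat.cast_smul_eq_nsmul ℂ, smul_smul,
    inv_mul_cancel₀ (Nat.cast_ne_zero.2 Fintype.card_ne_zero), one_smul]

/-- `‖mean f‖ ≤ r` when every `‖f i‖ ≤ r` (`0 ≤ r`). [folklore] -/
theorem norm_meanCLM_le_of_forall_le (f : ι → 𝔸) {r : ℝ} (hr : 0 ≤ r) (h : ∀ i, ‖f i‖ ≤ r) : ‖meanCLM ι 𝔸 f‖ ≤ r :=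
  (norm_meanCLM_apply_le f).trans ((pi_norm_le_iff_of_nonneg hr).2 h)

/-! ## §2 The three-level BCH map -/

section Main

variable [CompleteSpace 𝔸]

/-- **THE EXACT IDENTITY**: in the smallness regime `F(a,b) := bchLog (−m) a`, `m := mean_i bchLog a (bchLog Z_i (−b_i))`, satisfies `exp F = exp(−m)·exp a` — so `F` is
the logarithm of `v⁻¹·g(emb y)` once `exp m` is the frame of the gauge copy. [cite: Balaban1987RG1, (0.6) p.253] -/
theorem exp_threeLevelBCH (Z : ι → 𝔸) (a : 𝔸) (b : ι → 𝔸) {ζ ℓ : ℝ} (hζ : 0 ≤ ζ) (hℓ : 0 ≤ ℓ)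
    (hZ : ∀ i, ‖Z i‖ ≤ ζ) (ha : ‖a‖ ≤ ℓ) (hb : ∀ i, ‖b i‖ ≤ ℓ) (hs : ζ + 2 * ℓ ≤ 1 / 100) :
    exp (bchLog (-(meanCLM ι 𝔸 fun i => bchLog a (bchLog (Z i) (-(b i))))) a) =
      exp (-(meanCLM ι 𝔸 fun i => bchLog a (bchLog (Z i) (-(b i))))) * exp a := by
  -- sizes
  have hY : ∀ i, ‖bchLog (Z i) (-(b i))‖ ≤ 2 * (ζ + 2 * ℓ) := by
    intro i
    have h1 : ‖Z i‖ + ‖-(b i)‖ ≤ 1 / 8 := by rw [norm_neg]; linarith [hZ i, hb i]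
    have hrem := norm_bchRem_le h1
    have hsum : ‖Z i + -(b i)‖ ≤ ζ + ℓ := (norm_add_le _ _).trans (by rw [norm_neg]; linarith [hZ i, hb i])
    have hsq : 3 * (‖Z i‖ + ‖-(b i)‖) ^ 2 ≤ ζ + 2 * ℓ := by
      rw [norm_neg]
      have hle : ‖Z i‖ + ‖b i‖ ≤ ζ + 2 * ℓ := by linarith [hZ i, hb i]
      have h0 : 0 ≤ ‖Z i‖ + ‖b i‖ := by positivity
      nlinarith
    calc ‖bchLog (Z i) (-(b i))‖ = ‖(bchLog (Z i) (-(b i)) - (Z i + -(b i))) + (Z i + -(b i))‖ := by rw [sub_add_cancel]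
      _ ≤ ‖bchLog (Z i) (-(b i)) - (Z i + -(b i))‖ + ‖Z i + -(b i)‖ := norm_add_le _ _
      _ ≤ 2 * (ζ + 2 * ℓ) := by linarith
  have hm : ‖meanCLM ι 𝔸 fun i => bchLog a (bchLog (Z i) (-(b i)))‖ ≤ 4 * (ζ + 2 * ℓ) := by
    refine norm_meanCLM_le_of_forall_le _ (by linarith) fun i => ?_
    have h1 : ‖a‖ + ‖bchLog (Z i) (-(b i))‖ ≤ 1 / 8 := by linarith [hY i]
    have hrem := norm_bchRem_le h1
    have hle : ‖a‖ + ‖bchLog (Z i) (-(b i))‖ ≤ 3 * (ζ + 2 * ℓ) := by linarith [hY i]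
    have h0 : 0 ≤ ‖a‖ + ‖bchLog (Z i) (-(b i))‖ := by positivity
    have hsq : 3 * (‖a‖ + ‖bchLog (Z i) (-(b i))‖) ^ 2 ≤ ζ + 2 * ℓ := by nlinarith
    calc ‖bchLog a (bchLog (Z i) (-(b i)))‖
        = ‖(bchLog a (bchLog (Z i) (-(b i))) - (a + bchLog (Z i) (-(b i)))) + (a + bchLog (Z i) (-(b i)))‖ := by rw [sub_add_cancel]
      _ ≤ ‖bchLog a (bchLog (Z i) (-(b i))) - (a + bchLog (Z i) (-(b i)))‖ + ‖a + bchLog (Z i) (-(b i))‖ := norm_add_le _ _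
      _ ≤ 3 * (‖a‖ + ‖bchLog (Z i) (-(b i))‖) ^ 2 + (‖a‖ + ‖bchLog (Z i) (-(b i))‖) := by
          gcongr; exact norm_add_le _ _
      _ ≤ 4 * (ζ + 2 * ℓ) := by linarith
  have hsmall : ‖-(meanCLM ι 𝔸 fun i => bchLog a (bchLog (Z i) (-(b i))))‖ + ‖a‖ ≤ 1 / 4 := by
    rw [norm_neg]; linarith
  exact exp_bchLog (norm_expMul_sub_one_lt_one hsmall)

variable [Nonempty ι]

/-- **★ THE THREE-LEVEL BCH MAP IS THE MEAN UP TO AN `O(ζ + ℓ)`-LIPSCHITZ REMAINDER**: for `‖Z_i‖ ≤ ζ`, `‖a‖, ‖a′‖, ‖b_i‖, ‖b′_i‖ ≤ ℓ`, `ζ + 2ℓ ≤ 1/100` and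
`‖a − a′‖, ‖b_i − b′_i‖ ≤ D`, the deviations `Θ := F(a,b) − (−mean Z + mean b)` satisfy `‖Θ − Θ′‖ ≤ 100(ζ + 2ℓ)·D` — the base-point value `a` has NO linear
effect, the linear part is the plain mean of `b` (print: «Q′(u₁,λ) is almost equal to Q′λ, the error is of second order in α₃, α₄»). [cite: Balaban1985RegularSpaces, Sect. E p.95; Balaban1987RG1, (0.8) p.253] -/
theorem threeLevelBCH_sub_mean_lipschitz (Z : ι → 𝔸) (a a' : 𝔸) (b b' : ι → 𝔸) {ζ ℓ D : ℝ} (hζ : 0 ≤ ζ) (hℓ : 0 ≤ ℓ) (hD : 0 ≤ D)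
    (hZ : ∀ i, ‖Z i‖ ≤ ζ) (ha : ‖a‖ ≤ ℓ) (ha' : ‖a'‖ ≤ ℓ) (hb : ∀ i, ‖b i‖ ≤ ℓ) (hb' : ∀ i, ‖b' i‖ ≤ ℓ)
    (hs : ζ + 2 * ℓ ≤ 1 / 100) (hda : ‖a - a'‖ ≤ D) (hdb : ∀ i, ‖b i - b' i‖ ≤ D) :
    ‖(bchLog (-(meanCLM ι 𝔸 fun i => bchLog a (bchLog (Z i) (-(b i))))) a - (-(meanCLM ι 𝔸 Z) + meanCLM ι 𝔸 b)) -
        (bchLog (-(meanCLM ι 𝔸 fun i => bchLog a' (bchLog (Z i) (-(b' i))))) a' - (-(meanCLM ι 𝔸 Z) + meanCLM ι 𝔸 b'))‖ ≤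
      100 * (ζ + 2 * ℓ) * D := by
  -- abbreviations (as local definitions through `set`)
  set s : ℝ := ζ + 2 * ℓ with hs_def
  have hs0 : 0 ≤ s := by rw [hs_def]; positivity
  -- level 1: `R₁ i := bchLog (Z i) (−b i) − (Z i − b i)` and its primed twin
  set R₁ : ι → 𝔸 := fun i => bchLog (Z i) (-(b i)) - (Z i + -(b i)) with hR₁
  set R₁' : ι → 𝔸 := fun i => bchLog (Z i) (-(b' i)) - (Z i + -(b' i)) with hR₁'
  have hZb : ∀ i, ‖Z i‖ + ‖-(b i)‖ ≤ 1 / 8 := fun i => by rw [norm_neg]; linarith [hZ i, hb i]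
  have hZb' : ∀ i, ‖Z i‖ + ‖-(b' i)‖ ≤ 1 / 8 := fun i => by rw [norm_neg]; linarith [hZ i, hb' i]
  have hR₁n : ∀ i, ‖R₁ i‖ ≤ s := by
    intro i
    have h := norm_bchRem_le (hZb i)
    have hle : ‖Z i‖ + ‖-(b i)‖ ≤ s := by rw [norm_neg, hs_def]; linarith [hZ i, hb i]
    have h0 : 0 ≤ ‖Z i‖ + ‖-(b i)‖ := by positivity
    have : 3 * (‖Z i‖ + ‖-(b i)‖) ^ 2 ≤ s := by nlinarith
    exact h.trans this
  have hR₁n' : ∀ i, ‖R₁' i‖ ≤ s := by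
    intro i
    have h := norm_bchRem_le (hZb' i)
    have hle : ‖Z i‖ + ‖-(b' i)‖ ≤ s := by rw [norm_neg, hs_def]; linarith [hZ i, hb' i]
    have h0 : 0 ≤ ‖Z i‖ + ‖-(b' i)‖ := by positivity
    have : 3 * (‖Z i‖ + ‖-(b' i)‖) ^ 2 ≤ s := by nlinarith
    exact h.trans this
  have hR₁d : ∀ i, ‖R₁ i - R₁' i‖ ≤ 3 * s * D := by
    intro i
    have h := norm_bchRem_sub_bchRem_le (X₁ := Z i) (Y₁ := -(b i)) (X₂ := Z i) (Y₂ := -(b' i)) (a := ζ) (a' := ℓ)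
      (hZ i) (hZ i) (by rw [norm_neg]; exact hb i) (by rw [norm_neg]; exact hb' i) (by linarith)
    have hn : ‖Z i - Z i‖ + ‖-(b i) - -(b' i)‖ = ‖b i - b' i‖ := by
      rw [sub_self, norm_zero, zero_add, neg_sub_neg, norm_sub_rev]
    rw [hn] at h
    have h1 : ζ + ℓ ≤ s := by rw [hs_def]; linarith
    have h2 : 0 ≤ ζ + ℓ := by positivity
    change ‖(bchLog (Z i) (-(b i)) - (Z i + -(b i))) - (bchLog (Z i) (-(b' i)) - (Z i + -(b' i)))‖ ≤ 3 * s * D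
    calc ‖(bchLog (Z i) (-(b i)) - (Z i + -(b i))) - (bchLog (Z i) (-(b' i)) - (Z i + -(b' i)))‖
        ≤ 3 * (ζ + ℓ) * ‖b i - b' i‖ := h
      _ ≤ 3 * (ζ + ℓ) * D := by gcongr; exact hdb i
      _ ≤ 3 * s * D := by gcongr
  -- level 2: `Y i := bchLog (Z i) (−b i) = Z i − b i + R₁ i`, `R₂ i := bchLog a (Y i) − (a + Y i)`
  have hYeq : ∀ i, bchLog (Z i) (-(b i)) = Z i + -(b i) + R₁ i := fun i => (add_sub_cancel _ _).symm
  have hYeq' : ∀ i, bchLog (Z i) (-(b' i)) = Z i + -(b' i) + R₁' i := fun i => (add_sub_cancel _ _).symm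
  have hYn : ∀ i, ‖bchLog (Z i) (-(b i))‖ ≤ 2 * s := by
    intro i; rw [hYeq i]
    calc ‖Z i + -(b i) + R₁ i‖ ≤ ‖Z i‖ + ‖-(b i)‖ + ‖R₁ i‖ := norm_add₃_le
      _ ≤ 2 * s := by rw [norm_neg, hs_def]; linarith [hZ i, hb i, hR₁n i, hs_def]
  have hYn' : ∀ i, ‖bchLog (Z i) (-(b' i))‖ ≤ 2 * s := by
    intro i; rw [hYeq' i]
    calc ‖Z i + -(b' i) + R₁' i‖ ≤ ‖Z i‖ + ‖-(b' i)‖ + ‖R₁' i‖ := norm_add₃_le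
      _ ≤ 2 * s := by rw [norm_neg, hs_def]; linarith [hZ i, hb' i, hR₁n' i, hs_def]
  have hYd : ∀ i, ‖bchLog (Z i) (-(b i)) - bchLog (Z i) (-(b' i))‖ ≤ 2 * D := by
    intro i; rw [hYeq i, hYeq' i]
    have : Z i + -(b i) + R₁ i - (Z i + -(b' i) + R₁' i) = -(b i - b' i) + (R₁ i - R₁' i) := by abel
    rw [this]
    calc ‖-(b i - b' i) + (R₁ i - R₁' i)‖ ≤ ‖-(b i - b' i)‖ + ‖R₁ i - R₁' i‖ := norm_add_le _ _
      _ ≤ D + 3 * s * D := by rw [norm_neg]; linarith [hdb i, hR₁d i]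
      _ ≤ 2 * D := by nlinarith
  set R₂ : ι → 𝔸 := fun i => bchLog a (bchLog (Z i) (-(b i))) - (a + bchLog (Z i) (-(b i))) with hR₂
  set R₂' : ι → 𝔸 := fun i => bchLog a' (bchLog (Z i) (-(b' i))) - (a' + bchLog (Z i) (-(b' i))) with hR₂'
  have hℓs : ℓ ≤ s := by rw [hs_def]; linarith
  have hR₂n : ∀ i, ‖R₂ i‖ ≤ s := by
    intro i
    have h1 : ‖a‖ + ‖bchLog (Z i) (-(b i))‖ ≤ 1 / 8 := by linarith [hYn i]
    have h := norm_bchRem_le h1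
    have hle : ‖a‖ + ‖bchLog (Z i) (-(b i))‖ ≤ 3 * s := by linarith [hYn i]
    have h0 : 0 ≤ ‖a‖ + ‖bchLog (Z i) (-(b i))‖ := by positivity
    have : 3 * (‖a‖ + ‖bchLog (Z i) (-(b i))‖) ^ 2 ≤ s := by nlinarith
    exact h.trans this
  have hR₂n' : ∀ i, ‖R₂' i‖ ≤ s := by
    intro i
    have h1 : ‖a'‖ + ‖bchLog (Z i) (-(b' i))‖ ≤ 1 / 8 := by linarith [hYn' i]
    have h := norm_bchRem_le h1
    have hle : ‖a'‖ + ‖bchLog (Z i) (-(b' i))‖ ≤ 3 * s := by linarith [hYn' i]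
    have h0 : 0 ≤ ‖a'‖ + ‖bchLog (Z i) (-(b' i))‖ := by positivity
    have : 3 * (‖a'‖ + ‖bchLog (Z i) (-(b' i))‖) ^ 2 ≤ s := by nlinarith
    exact h.trans this
  have hR₂d : ∀ i, ‖R₂ i - R₂' i‖ ≤ 27 * s * D := by
    intro i
    have h := norm_bchRem_sub_bchRem_le (X₁ := a) (Y₁ := bchLog (Z i) (-(b i))) (X₂ := a') (Y₂ := bchLog (Z i) (-(b' i)))
      (a := ℓ) (a' := 2 * s) ha ha' (hYn i) (hYn' i) (by linarith)
    calc ‖R₂ i - R₂' i‖ ≤ 3 * (ℓ + 2 * s) * (‖a - a'‖ + ‖bchLog (Z i) (-(b i)) - bchLog (Z i) (-(b' i))‖) := h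
      _ ≤ 3 * (3 * s) * (D + 2 * D) := by
          have h0 : 0 ≤ ℓ + 2 * s := by positivity
          gcongr
          · linarith
          · exact hYd i
      _ = 27 * s * D := by ring
  -- the means
  set m : 𝔸 := meanCLM ι 𝔸 fun i => bchLog a (bchLog (Z i) (-(b i))) with hm
  set m' : 𝔸 := meanCLM ι 𝔸 fun i => bchLog a' (bchLog (Z i) (-(b' i))) with hm'
  have hpt : ∀ i, bchLog a (bchLog (Z i) (-(b i))) = a + (Z i + -(b i)) + R₁ i + R₂ i := by
    intro i
    have h2 : bchLog a (bchLog (Z i) (-(b i))) = (a + bchLog (Z i) (-(b i))) + R₂ i := (add_sub_cancel _ _).symm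
    rw [h2, hYeq i]; abel
  have hpt' : ∀ i, bchLog a' (bchLog (Z i) (-(b' i))) = a' + (Z i + -(b' i)) + R₁' i + R₂' i := by
    intro i
    have h2 : bchLog a' (bchLog (Z i) (-(b' i))) = (a' + bchLog (Z i) (-(b' i))) + R₂' i := (add_sub_cancel _ _).symm
    rw [h2, hYeq' i]; abel
  have hmeq : m = a + (meanCLM ι 𝔸 Z + -(meanCLM ι 𝔸 b)) + meanCLM ι 𝔸 R₁ + meanCLM ι 𝔸 R₂ := by
    have hfun : (fun i => bchLog a (bchLog (Z i) (-(b i)))) = (fun _ : ι => a) + (Z + -b) + R₁ + R₂ := by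
      funext i; simp only [Pi.add_apply, Pi.neg_apply]; exact hpt i
    rw [hm, hfun, map_add, map_add, map_add, map_add, map_neg, meanCLM_const]
  have hmeq' : m' = a' + (meanCLM ι 𝔸 Z + -(meanCLM ι 𝔸 b')) + meanCLM ι 𝔸 R₁' + meanCLM ι 𝔸 R₂' := by
    have hfun : (fun i => bchLog a' (bchLog (Z i) (-(b' i)))) = (fun _ : ι => a') + (Z + -b') + R₁' + R₂' := by
      funext i; simp only [Pi.add_apply, Pi.neg_apply]; exact hpt' i
    rw [hm', hfun, map_add, map_add, map_add, map_add, map_neg, meanCLM_const]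
  have hmn : ‖m‖ ≤ 4 * s := by
    rw [hm]
    refine norm_meanCLM_le_of_forall_le _ (by positivity) fun i => ?_
    have : bchLog a (bchLog (Z i) (-(b i))) = (a + bchLog (Z i) (-(b i))) + R₂ i := (add_sub_cancel _ _).symm
    rw [this]
    calc ‖a + bchLog (Z i) (-(b i)) + R₂ i‖ ≤ ‖a‖ + ‖bchLog (Z i) (-(b i))‖ + ‖R₂ i‖ := norm_add₃_le
      _ ≤ 4 * s := by linarith [hYn i, hR₂n i]
  have hmn' : ‖m'‖ ≤ 4 * s := by
    rw [hm']
    refine norm_meanCLM_le_of_forall_le _ (by positivity) fun i => ?_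
    have : bchLog a' (bchLog (Z i) (-(b' i))) = (a' + bchLog (Z i) (-(b' i))) + R₂' i := (add_sub_cancel _ _).symm
    rw [this]
    calc ‖a' + bchLog (Z i) (-(b' i)) + R₂' i‖ ≤ ‖a'‖ + ‖bchLog (Z i) (-(b' i))‖ + ‖R₂' i‖ := norm_add₃_le
      _ ≤ 4 * s := by linarith [hYn' i, hR₂n' i]
  have hmd : ‖m - m'‖ ≤ 32 * s * D + 2 * D := by
    rw [hmeq, hmeq']
    have : a + (meanCLM ι 𝔸 Z + -(meanCLM ι 𝔸 b)) + meanCLM ι 𝔸 R₁ + meanCLM ι 𝔸 R₂ -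
        (a' + (meanCLM ι 𝔸 Z + -(meanCLM ι 𝔸 b')) + meanCLM ι 𝔸 R₁' + meanCLM ι 𝔸 R₂') =
        (a - a') - meanCLM ι 𝔸 (b - b') + meanCLM ι 𝔸 (R₁ - R₁') + meanCLM ι 𝔸 (R₂ - R₂') := by
      rw [map_sub, map_sub, map_sub]; abel
    rw [this]
    have h1 : ‖meanCLM ι 𝔸 (b - b')‖ ≤ D := norm_meanCLM_le_of_forall_le _ hD fun i => hdb i
    have h2 : ‖meanCLM ι 𝔸 (R₁ - R₁')‖ ≤ 3 * s * D := norm_meanCLM_le_of_forall_le _ (by positivity) fun i => hR₁d i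
    have h3 : ‖meanCLM ι 𝔸 (R₂ - R₂')‖ ≤ 27 * s * D := norm_meanCLM_le_of_forall_le _ (by positivity) fun i => hR₂d i
    calc ‖a - a' - meanCLM ι 𝔸 (b - b') + meanCLM ι 𝔸 (R₁ - R₁') + meanCLM ι 𝔸 (R₂ - R₂')‖
        ≤ ‖a - a' - meanCLM ι 𝔸 (b - b')‖ + ‖meanCLM ι 𝔸 (R₁ - R₁')‖ + ‖meanCLM ι 𝔸 (R₂ - R₂')‖ := norm_add₃_le
      _ ≤ (‖a - a'‖ + ‖meanCLM ι 𝔸 (b - b')‖) + ‖meanCLM ι 𝔸 (R₁ - R₁')‖ + ‖meanCLM ι 𝔸 (R₂ - R₂')‖ := by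
          gcongr; exact norm_sub_le _ _
      _ ≤ (D + D) + 3 * s * D + 27 * s * D := by linarith [hda, h1, h2, h3]
      _ ≤ 32 * s * D + 2 * D := by nlinarith [mul_nonneg hs0 hD]
  -- level 3: `R₃ := bchLog (−m) a − (−m + a)`
  set R₃ : 𝔸 := bchLog (-m) a - (-m + a) with hR₃
  set R₃' : 𝔸 := bchLog (-m') a' - (-m' + a') with hR₃'
  have hR₃d : ‖R₃ - R₃'‖ ≤ 50 * s * D := by
    have h := norm_bchRem_sub_bchRem_le (X₁ := -m) (Y₁ := a) (X₂ := -m') (Y₂ := a') (a := 4 * s) (a' := ℓ)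
      (by rw [norm_neg]; exact hmn) (by rw [norm_neg]; exact hmn') ha ha' (by linarith)
    rw [← hR₃, ← hR₃'] at h
    calc ‖R₃ - R₃'‖ ≤ 3 * (4 * s + ℓ) * (‖-m - -m'‖ + ‖a - a'‖) := h
      _ ≤ 3 * (5 * s) * ((32 * s * D + 2 * D) + D) := by
          have h0 : 0 ≤ 4 * s + ℓ := by positivity
          gcongr
          · linarith
          · rw [neg_sub_neg, norm_sub_rev]; exact hmd
      _ ≤ 50 * s * D := by
          have hsD : 0 ≤ s * D := mul_nonneg hs0 hD
          nlinarith [mul_le_mul_of_nonneg_right hs hsD]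
  -- the algebra: `Θ = R₃ − mean R₁ − mean R₂`
  have hΘ : bchLog (-m) a - (-(meanCLM ι 𝔸 Z) + meanCLM ι 𝔸 b) = R₃ - meanCLM ι 𝔸 R₁ - meanCLM ι 𝔸 R₂ := by
    rw [hR₃, hmeq]; abel
  have hΘ' : bchLog (-m') a' - (-(meanCLM ι 𝔸 Z) + meanCLM ι 𝔸 b') = R₃' - meanCLM ι 𝔸 R₁' - meanCLM ι 𝔸 R₂' := by
    rw [hR₃', hmeq']; abel
  rw [hΘ, hΘ']
  have : R₃ - meanCLM ι 𝔸 R₁ - meanCLM ι 𝔸 R₂ - (R₃' - meanCLM ι 𝔸 R₁' - meanCLM ι 𝔸 R₂') =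
      (R₃ - R₃') - meanCLM ι 𝔸 (R₁ - R₁') - meanCLM ι 𝔸 (R₂ - R₂') := by
    rw [map_sub, map_sub]; abel
  rw [this]
  have h2 : ‖meanCLM ι 𝔸 (R₁ - R₁')‖ ≤ 3 * s * D := norm_meanCLM_le_of_forall_le _ (by positivity) fun i => hR₁d i
  have h3 : ‖meanCLM ι 𝔸 (R₂ - R₂')‖ ≤ 27 * s * D := norm_meanCLM_le_of_forall_le _ (by positivity) fun i => hR₂d i
  calc ‖R₃ - R₃' - meanCLM ι 𝔸 (R₁ - R₁') - meanCLM ι 𝔸 (R₂ - R₂')‖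
      ≤ ‖R₃ - R₃' - meanCLM ι 𝔸 (R₁ - R₁')‖ + ‖meanCLM ι 𝔸 (R₂ - R₂')‖ := norm_sub_le _ _
    _ ≤ ‖R₃ - R₃'‖ + ‖meanCLM ι 𝔸 (R₁ - R₁')‖ + ‖meanCLM ι 𝔸 (R₂ - R₂')‖ := by gcongr; exact norm_sub_le _ _
    _ ≤ 50 * s * D + 3 * s * D + 27 * s * D := by linarith
    _ ≤ 100 * (ζ + 2 * ℓ) * D := by rw [hs_def]; nlinarith

/-- `bchLog X 0 = X` for `‖X‖ < ln 2` (`log(e^X·1) = X`, ✓`mlog_exp`). [folklore] -/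
theorem bchLog_zero_right {X : 𝔸} (hX : ‖X‖ < Real.log 2) : bchLog X 0 = X := by
  rw [bchLog, exp_zero, mul_one, ← MatrixLog.mlog_def]
  exact B7BlockAvgLog.mlog_exp hX

/-- `bchLog 0 Y = Y` for `‖Y‖ < ln 2`. [folklore] -/
theorem bchLog_zero_left {Y : 𝔸} (hY : ‖Y‖ < Real.log 2) : bchLog 0 Y = Y := by
  rw [bchLog, exp_zero, one_mul, ← MatrixLog.mlog_def]
  exact B7BlockAvgLog.mlog_exp hY

/-- **★ AT ONE POINT**: `‖F(a,b) − (−mean Z + mean b)‖ ≤ 100(ζ + 2ℓ)·ℓ` — the three-level BCH map of the frame IS the mean of `b` up to a second-order term, and the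
base-point value `a` does not enter at first order (the Lipschitz bound at `(a′,b′) = (0,0)`, where `F(0,0) = −mean Z` exactly). [cite: Balaban1985RegularSpaces, Sect. E p.95; Balaban1987RG1, (0.8) p.253] -/
theorem threeLevelBCH_sub_mean_le (Z : ι → 𝔸) (a : 𝔸) (b : ι → 𝔸) {ζ ℓ : ℝ} (hζ : 0 ≤ ζ) (hℓ : 0 ≤ ℓ)
    (hZ : ∀ i, ‖Z i‖ ≤ ζ) (ha : ‖a‖ ≤ ℓ) (hb : ∀ i, ‖b i‖ ≤ ℓ) (hs : ζ + 2 * ℓ ≤ 1 / 100) :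
    ‖bchLog (-(meanCLM ι 𝔸 fun i => bchLog a (bchLog (Z i) (-(b i))))) a - (-(meanCLM ι 𝔸 Z) + meanCLM ι 𝔸 b)‖ ≤
      100 * (ζ + 2 * ℓ) * ℓ := by
  have hlog2 : (1 : ℝ) / 100 < Real.log 2 := by linarith [Real.log_two_gt_d9]
  have h := threeLevelBCH_sub_mean_lipschitz Z a 0 b (fun _ => 0) hζ hℓ hℓ hZ ha (by rw [norm_zero]; exact hℓ) hb
    (fun _ => by rw [norm_zero]; exact hℓ) hs (by rw [sub_zero]; exact ha) (fun i => by rw [sub_zero]; exact hb i)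
  -- the primed deviation vanishes: `F(0,0) = bchLog (−mean Z) 0 = −mean Z`
  have hZi : ∀ i, bchLog (0 : 𝔸) (bchLog (Z i) (-(0 : 𝔸))) = Z i := by
    intro i
    have hZlt : ‖Z i‖ < Real.log 2 := (hZ i).trans_lt (by linarith)
    rw [neg_zero, bchLog_zero_right hZlt, bchLog_zero_left hZlt]
  have hmean : (meanCLM ι 𝔸 fun i => bchLog (0 : 𝔸) (bchLog (Z i) (-(0 : 𝔸)))) = meanCLM ι 𝔸 Z := by
    congr 1; funext i; exact hZi i
  have hmZ : ‖-(meanCLM ι 𝔸 Z)‖ < Real.log 2 := by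
    rw [norm_neg]
    exact (norm_meanCLM_le_of_forall_le Z hζ hZ).trans_lt (by linarith)
  have hzero : bchLog (-(meanCLM ι 𝔸 fun i => bchLog (0 : 𝔸) (bchLog (Z i) (-(0 : 𝔸))))) 0 -
      (-(meanCLM ι 𝔸 Z) + meanCLM ι 𝔸 (fun _ : ι => (0 : 𝔸))) = 0 := by
    rw [hmean, bchLog_zero_right hmZ]
    have : (fun _ : ι => (0 : 𝔸)) = 0 := rfl
    rw [this, map_zero, add_zero, sub_self]
  rw [hzero, sub_zero] at h
  exact h

end Main

end Summit.QuantumFields.YangMills.Theorems.P1FlatCoreFrameLinBCH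

end
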